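import Summits.NavierStokesRegularity.NavierStokesRegularity.Theorems.TypeIIInviscidRelaxationAxisymSwirlRegularCoreStrainCriterion
import Summits.NavierStokesRegularity.NavierStokesRegularity.Theorems.TypeIIInviscidRelaxationAxisymSwirlRegularRadialMomentumCalculus
import Summits.NavierStokesRegularity.NavierStokesRegularity.Theorems.ScenarioCensusRowF5lg
import Literature.Analysis.FluidPDE.AxisymHouLiVariables
import HarnessLib

/-!
# Axial-stretching form of the one-sided radial criterion: incompressibility turns a one-sided bound on
# `∂_z u_z` near the axis into the radial inflow gate

Helper toward the crux `AxisymSwirlRegular` (stmt-NavierStokesRegularity-1964, route TypeIIInviscidRelaxation),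
criterion side of the registered line `radial_inflow_split` (stub `stub_oneSidedRadialCriterion`, ⟨19059⟩:
`x₀u₀ + x₁u₁ = r u_r ≥ −Cν` on an axis tube for SOME `C` ⇒ continuation; a tree theorem for `C < 2`,
`ScenarioCensus.LogGate.oneSidedRadialCriterion_of_lt_two`, open for `C ≥ 2`).

Every criterion landed so far for this crux constrains the radial velocity `u_r` itself (gates, envelopes,
core Reynolds numbers, `u_r/r` rates).  This file brings in the first piece of the Navier–Stokes COUPLING that the
repair census asks for — incompressibility — in its most elementary form.  For an axisymmetric divergence-free
`C¹` field the radial momentum `Φ = x₀u₀ + x₁u₁ = r u_r` satisfies, along every horizontal ray from the axis,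

  `∂_r Φ = −r ∂_z u_z`            (`(1/r)∂_r(r u_r) + ∂_z u_z = div u = 0`),

so `Φ(x) = −∫₀^{r} s ∂_z u_z ds`: RADIAL INFLOW TOWARDS THE AXIS IS THE INTEGRAL OF AXIAL STRETCHING.  Hence a
one-sided bound on the axial strain, `∂_z u_z ≤ K` on the horizontal disc through `x`, gives `Φ(x) ≥ −K r²/2`
(`radialMomentum_ge_of_axialStrain_le`, proved from the tree's `fderiv_radialMomentum_horizontal_of_isAxisymmetric`
and the mean value theorem), and:

* `hasSmoothExtensionPast_of_axialStrain_le` — **axial-stretching criterion**: in the standing class of the stub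
  (classical on `[0,T)`, Leray–Hopf from `u 0`, bounded on closed sub-slabs, axisymmetric slices, rapidly decaying
  datum), if `∂_z u_z ≤ K` on an axis tube `{cylRadius < δ} × [0,T)` for SOME `K` (any size, no sign), then
  `HasSmoothExtensionPast ν 0 u T`.  Proof: `Φ ≥ −K⁺r²/2 ≥ −ν` on the tube `r < min δ √(ν/K⁺)`, i.e. the gate holds
  with constant `1 < 2`, and `oneSidedRadialCriterion_of_lt_two` applies.  The hypothesis is one-sided (axial
  COMPRESSION is free), concerns one diagonal entry of `∇u` only, and only near the axis;
* `exists_axialStretching_of_not_hasSmoothExtensionPast` — blow-up reading: a solution of the standing class that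
  does not extend past `T` has `sup_{cylRadius x < δ} ∂_z u_z (t,x) = +∞` over `[0,T)` for every `δ > 0`
  (unbounded axial stretching at points approaching the axis);
* `exists_coreWidth_axialStrainRate` / `oneSidedRadialCriterion_of_coreAxialStrain` — the parabolic-core form:
  under an inflow Reynolds gate of ANY size `Λ₀` on the unit tube (resp. the stub's own gate `∃ C δ`), a Type-I-rate
  bound `∂_z u_z ≤ κ₀/(T−t)` INSIDE the parabolic core `{r < ξ₀√(ν(T−t))}` suffices (`κ₀ = 2/ξ₀²`, twice the
  constant of the radial-rate version `RadialInflowCoreStrain.exists_coreWidth_strainRate`, because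
  `Φ ≥ −κ₀ r²/(2(T−t))`);
* `exists_coreAxialStretching_of_not_hasSmoothExtensionPast` — its blow-up reading.

Scaling: `∂_z u_z` has the dimension of `1/time`; a bound by a fixed `K` up to `T` is subcritical, the core version
is at the Type-I rate.  In print the one-sided radial criteria are X. Pan, Acta Appl. Math. 150 (2017) (`M = 1`) and
Zujin Zhang, JMAA 461 (2018) (`1 < M < 2`), as cited by Q. S. Zhang, arXiv:2604.07785, p. 4; one-component /
one-entry gradient criteria in critical Lebesgue norms (Neustupa–Pokorný 2000, Kubica 2015 for `u_r^±`; Skalák 2021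
for one diagonal entry of `∇u`) are two-sided or integral conditions.  The statements here are elementary
corollaries of the `C < 2` criterion and `div u = 0`; a CRITERION and its contrapositive — nothing here proves
`stub_oneSidedRadialCriterion` (open half `C ≥ 2`), `AxisymSwirlRegular` or NavierStokesRegularity. [new]
-/

noncomputable section

set_option linter.dupNamespace false

open Set Filter Topology Real WithLp
open Literature.Analysis.FluidPDE
open scoped InnerProductSpace RealInnerProductSpace

namespace Summit.NavierStokesRegularity.NavierStokesRegularity.Theorems.RadialInflowAxialStrain

open Summit.NavierStokesRegularity.NavierStokesRegularity.Theorems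
open Summit.NavierStokesRegularity.NavierStokesRegularity.Theorems.RadialInflowCoreReynolds
open Summit.NavierStokesRegularity.NavierStokesRegularity.Theorems.RadialInflowCoreStrain
open Summit.NavierStokesRegularity.NavierStokesRegularity.Theorems.ScenarioCensus.LogGate

/-! ## §1 Kinematics: radial momentum from axial strain (axisymmetric, divergence free) -/

/-- **Horizontal divergence = minus axial strain** for a divergence-free field on `ℝ³`:
`∂₀u₀ + ∂₁u₁ = −∂₂u₂`. [folklore] -/
theorem divH_eq_neg_axialStrain {v : EuclideanSpace ℝ (Fin 3) → EuclideanSpace ℝ (Fin 3)}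
    (hdiv : VectorCalculus.IsDivFree v) (y : EuclideanSpace ℝ (Fin 3)) :
    fderiv ℝ v y (EuclideanSpace.single 0 1) 0 + fderiv ℝ v y (EuclideanSpace.single 1 1) 1 =
      -fderiv ℝ v y (EuclideanSpace.single 2 1) 2 := by
  have h := divergence_eq_sum_three v y
  rw [hdiv y] at h
  linarith

/-- **Radial momentum from one-sided axial strain.** Let `v : ℝ³ → ℝ³` be differentiable, axisymmetric and
divergence free, and let `x ∈ ℝ³`.  If the axial strain obeys `∂₂v₂(y) ≤ K` at every point `y` off the axis of the
horizontal disc through `x` (`0 < cylRadius y ≤ cylRadius x`, `y₂ = x₂`), then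
`x₀v₀(x) + x₁v₁(x) = r u_r (x) ≥ −K r²/2`, `r = cylRadius x`.  Proof: along the ray `s ↦ (s x₀, s x₁, x₂)` the
radial momentum `g(s)` has `g(0) = 0` and `g′(s) = s r²(∂₀v₀ + ∂₁v₁) = −s r² ∂₂v₂ ≥ −K r² s`
(`fderiv_radialMomentum_horizontal_of_isAxisymmetric`, `div v = 0`), so `g(s) + K r² s²/2` is nondecreasing on
`[0,1]`. [new; folklore kinematics] -/
theorem radialMomentum_ge_of_axialStrain_le {v : EuclideanSpace ℝ (Fin 3) → EuclideanSpace ℝ (Fin 3)}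
    (hv : Differentiable ℝ v) (hax : IsAxisymmetric v) (hdiv : VectorCalculus.IsDivFree v)
    {x : EuclideanSpace ℝ (Fin 3)} {K : ℝ}
    (hK : ∀ y : EuclideanSpace ℝ (Fin 3), 0 < cylRadius y → cylRadius y ≤ cylRadius x → y 2 = x 2 →
      fderiv ℝ v y (EuclideanSpace.single 2 1) 2 ≤ K) :
    -(K * cylRadius x ^ 2 / 2) ≤ x 0 * v x 0 + x 1 * v x 1 := by
  rcases (cylRadius_nonneg x).eq_or_lt with hr0 | hr0
  · -- on the axis both sides vanish
    have h0 := (cylRadius_eq_zero_iff x).1 hr0.symm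
    rw [← hr0, h0.1, h0.2]
    simp
  -- the ray `γ s = (s x₀, s x₁, x₂)` from the axis foot `a` to `x`
  set a : EuclideanSpace ℝ (Fin 3) := toLp 2 ![0, 0, x 2] with ha_def
  set w : EuclideanSpace ℝ (Fin 3) := toLp 2 ![x 0, x 1, 0] with hw_def
  set γ : ℝ → EuclideanSpace ℝ (Fin 3) := fun s => a + s • w with hγ_def
  have hγ0 : ∀ s, γ s 0 = s * x 0 := fun s => by simp [hγ_def, ha_def, hw_def]
  have hγ1 : ∀ s, γ s 1 = s * x 1 := fun s => by simp [hγ_def, ha_def, hw_def]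
  have hγ2 : ∀ s, γ s 2 = x 2 := fun s => by simp [hγ_def, ha_def, hw_def]
  have hγone : γ 1 = x := by
    ext i
    fin_cases i <;> simp [hγ_def, ha_def, hw_def]
  have hrγ : ∀ s, 0 ≤ s → cylRadius (γ s) = s * cylRadius x := fun s hs => by
    unfold cylRadius
    rw [hγ0, hγ1, show (s * x 0) ^ 2 + (s * x 1) ^ 2 = s ^ 2 * (x 0 ^ 2 + x 1 ^ 2) by ring,
      Real.sqrt_mul (sq_nonneg s), Real.sqrt_sq hs]
  have hrγsq : ∀ s, cylRadius (γ s) ^ 2 = s ^ 2 * cylRadius x ^ 2 := fun s => by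
    rw [cylRadius_sq, cylRadius_sq, hγ0, hγ1]
    ring
  have hhor : ∀ s, (toLp 2 ![γ s 0, γ s 1, 0] : EuclideanSpace ℝ (Fin 3)) = s • w := fun s => by
    ext i
    fin_cases i <;> simp [hγ0, hγ1, hw_def]
  have hderγ : ∀ s, HasDerivAt γ w s := fun s => by
    have h := ((hasDerivAt_id s).smul_const w).const_add a
    simpa [hγ_def] using h
  -- the radial momentum is differentiable
  have hΦd : ∀ y, DifferentiableAt ℝ (fun y : EuclideanSpace ℝ (Fin 3) => y 0 * v y 0 + y 1 * v y 1) y :=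
    fun y => by
    rw [radialMomentum_eq_inner_rotGen]
    exact (hasFDerivAt_rotGen y).differentiableAt.inner ℝ (hasFDerivAt_rotGen_comp (hv y)).differentiableAt
  -- `g(s) = Φ(γ s)` and its derivative
  set g : ℝ → ℝ := fun s => γ s 0 * v (γ s) 0 + γ s 1 * v (γ s) 1 with hg_def
  have hderg : ∀ s, HasDerivAt g
      (fderiv ℝ (fun y : EuclideanSpace ℝ (Fin 3) => y 0 * v y 0 + y 1 * v y 1) (γ s) w) s :=
    fun s => (hΦd (γ s)).hasFDerivAt.comp_hasDerivAt s (hderγ s)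
  -- the derivative along the ray: `s · g′(s) = s² r² (∂₀v₀ + ∂₁v₁)(γ s) = -s² r² ∂₂v₂(γ s)`
  have hkey : ∀ s, s * fderiv ℝ (fun y : EuclideanSpace ℝ (Fin 3) => y 0 * v y 0 + y 1 * v y 1) (γ s) w =
      -(s ^ 2 * cylRadius x ^ 2 * fderiv ℝ v (γ s) (EuclideanSpace.single 2 1) 2) := fun s => by
    have h := fderiv_radialMomentum_horizontal_of_isAxisymmetric hax (hv (γ s))
    rw [hhor s, map_smul, smul_eq_mul, hrγsq s, divH_eq_neg_axialStrain hdiv (γ s)] at h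
    linear_combination h
  -- `h(s) = g(s) + (K r²/2) s²` is nondecreasing on `[0, 1]`
  set h : ℝ → ℝ := fun s => g s + K * cylRadius x ^ 2 / 2 * s ^ 2 with hh_def
  have hderh : ∀ s, HasDerivAt h
      (fderiv ℝ (fun y : EuclideanSpace ℝ (Fin 3) => y 0 * v y 0 + y 1 * v y 1) (γ s) w
        + K * cylRadius x ^ 2 / 2 * (2 * s)) s := fun s => by
    have h2 : HasDerivAt (fun s : ℝ => s ^ 2) (2 * s) s := by simpa using hasDerivAt_pow 2 s
    exact (hderg s).add (h2.const_mul _)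
  have hmono : MonotoneOn h (Icc 0 1) := by
    refine monotoneOn_of_deriv_nonneg (convex_Icc 0 1)
      (fun s _ => (hderh s).continuousAt.continuousWithinAt)
      (fun s _ => (hderh s).differentiableAt.differentiableWithinAt) fun s hs => ?_
    rw [interior_Icc] at hs
    rw [(hderh s).deriv]
    -- at `γ s`, `0 < s < 1`: the point is off the axis, on the disc, at height `x₂`
    have hs0 : 0 < s := hs.1
    have hys : 0 < cylRadius (γ s) := by rw [hrγ s hs0.le]; positivity
    have hyle : cylRadius (γ s) ≤ cylRadius x := by
      rw [hrγ s hs0.le]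
      nlinarith [hs.2]
    have hA := hK (γ s) hys hyle (hγ2 s)
    have hk := hkey s
    -- `s · (g′(s) + K r² s) = s² r² (K - ∂₂v₂(γ s)) ≥ 0`
    have hprod : 0 ≤ s * (fderiv ℝ (fun y : EuclideanSpace ℝ (Fin 3) => y 0 * v y 0 + y 1 * v y 1) (γ s) w
        + K * cylRadius x ^ 2 / 2 * (2 * s)) := by
      have e : s * (fderiv ℝ (fun y : EuclideanSpace ℝ (Fin 3) => y 0 * v y 0 + y 1 * v y 1) (γ s) w
          + K * cylRadius x ^ 2 / 2 * (2 * s)) =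
          s ^ 2 * cylRadius x ^ 2 * (K - fderiv ℝ v (γ s) (EuclideanSpace.single 2 1) 2) := by
        linear_combination hk
      rw [e]
      exact mul_nonneg (by positivity) (by linarith)
    exact (mul_nonneg_iff_of_pos_left hs0).1 hprod
  -- compare the endpoints
  have h01 := hmono (left_mem_Icc.2 zero_le_one) (right_mem_Icc.2 zero_le_one) zero_le_one
  have hg0 : g 0 = 0 := by simp [hg_def, hγ0, hγ1]
  have hg1 : g 1 = x 0 * v x 0 + x 1 * v x 1 := by simp only [hg_def, hγone]
  have e0 : h 0 = 0 := by simp [hh_def, hg0]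
  have e1 : h 1 = x 0 * v x 0 + x 1 * v x 1 + K * cylRadius x ^ 2 / 2 := by
    simp only [hh_def, hg1]
    ring
  rw [e0, e1] at h01
  linarith

/-- The same bound in the radial-velocity currency: off the axis, `u_r(x) ≥ −K r/2`. [new; folklore kinematics] -/
theorem radialVelocity_ge_of_axialStrain_le {v : EuclideanSpace ℝ (Fin 3) → EuclideanSpace ℝ (Fin 3)}
    (hv : Differentiable ℝ v) (hax : IsAxisymmetric v) (hdiv : VectorCalculus.IsDivFree v)
    {x : EuclideanSpace ℝ (Fin 3)} {K : ℝ} (hx : 0 < cylRadius x)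
    (hK : ∀ y : EuclideanSpace ℝ (Fin 3), 0 < cylRadius y → cylRadius y ≤ cylRadius x → y 2 = x 2 →
      fderiv ℝ v y (EuclideanSpace.single 2 1) 2 ≤ K) :
    -(K * cylRadius x / 2) ≤ radialVelocity v x := by
  have h := radialMomentum_ge_of_axialStrain_le hv hax hdiv hK
  rw [radialVelocity_eq_div', le_div_iff₀ hx]
  have e : -(K * cylRadius x / 2) * cylRadius x = -(K * cylRadius x ^ 2 / 2) := by ring
  linarith

/-! ## §2 The axial-stretching criterion (any constant) -/

/-- **Axial-stretching criterion.** In the standing class of `stub_oneSidedRadialCriterion` (classical solution of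
the unforced system on `[0,T)` at viscosity `ν > 0`, Leray–Hopf on `[0,T]` from `u 0`, bounded on every closed
sub-slab, axisymmetric slices, rapidly decaying datum): if for some `K` and `δ > 0` the axial strain satisfies
`∂_z u_z (t,x) ≤ K` whenever `0 < cylRadius x < δ`, `t ∈ [0,T)`, then the solution extends smoothly past `T`.
Proof: by `radialMomentum_ge_of_axialStrain_le`, `r u_r ≥ −K⁺ r²/2 ≥ −ν` on the tube `r < min δ √(ν/K⁺)`
(`K⁺ = max K 1`), which is the one-sided radial gate with constant `1 < 2`:
`ScenarioCensus.LogGate.oneSidedRadialCriterion_of_lt_two`. [new] -/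
theorem hasSmoothExtensionPast_of_axialStrain_le {ν T K δ : ℝ} (hν : 0 < ν) (hT : 0 < T) (hδ : 0 < δ)
    {u : ℝ → EuclideanSpace ℝ (Fin 3) → EuclideanSpace ℝ (Fin 3)} {p : ℝ → EuclideanSpace ℝ (Fin 3) → ℝ}
    (hcl : IsClassicalNSSolutionOn (Ico 0 T) ν 0 u p) (hLH : IsLerayHopfOn T ν 0 (u 0) u)
    (hbd : ∀ T' < T, ∃ M : ℝ, ∀ t ∈ Icc 0 T', ∀ x, ‖u t x‖ ≤ M) (hax : ∀ t ∈ Ico 0 T, IsAxisymmetric (u t))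
    (hdec : HasRapidSpatialDecay (u 0))
    (hK : ∀ t ∈ Ico 0 T, ∀ x : EuclideanSpace ℝ (Fin 3), 0 < cylRadius x → cylRadius x < δ →
      fderiv ℝ (u t) x (EuclideanSpace.single 2 1) 2 ≤ K) :
    HasSmoothExtensionPast ν 0 u T := by
  set K' : ℝ := max K 1 with hK'_def
  have hK'0 : 0 < K' := lt_of_lt_of_le one_pos (le_max_right _ _)
  have hKK' : K ≤ K' := le_max_left _ _
  set δ' : ℝ := min δ (Real.sqrt (ν / K')) with hδ'_def
  have hδ'0 : 0 < δ' := lt_min hδ (Real.sqrt_pos.2 (div_pos hν hK'0))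
  refine oneSidedRadialCriterion_of_lt_two (C := 1) hν hT one_lt_two hδ'0 hcl hLH hbd hax hdec ?_
  intro t ht x hxδ'
  have hxδ : cylRadius x < δ := hxδ'.trans_le (min_le_left _ _)
  have hd : Differentiable ℝ (u t) := (hcl.contDiff_velocity ht).differentiable (by simp)
  have hΦ := radialMomentum_ge_of_axialStrain_le (K := K') hd (hax t ht) (hcl.divFree t ht)
    (x := x) fun y hy0 hyx _ => (hK t ht y hy0 (hyx.trans_lt hxδ)).trans hKK'
  -- `K' r² ≤ K' δ'² ≤ ν`
  have hr2 : cylRadius x ^ 2 ≤ ν / K' := by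
    have h1 : cylRadius x < Real.sqrt (ν / K') := hxδ'.trans_le (min_le_right _ _)
    have h2 : cylRadius x ^ 2 < Real.sqrt (ν / K') ^ 2 :=
      pow_lt_pow_left₀ h1 (cylRadius_nonneg x) two_ne_zero
    rw [Real.sq_sqrt (div_pos hν hK'0).le] at h2
    exact h2.le
  have h3 : cylRadius x ^ 2 * K' ≤ ν := (le_div_iff₀ hK'0).1 hr2
  nlinarith [h3, hΦ]

/-- **The criterion on the stub's hypothesis list** (universally closed form, for by-name comparison with
`stub_oneSidedRadialCriterion`: the gate hypothesis `∃ C δ, … −(Cν) ≤ x₀u₀ + x₁u₁` is REPLACED by the one-sided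
axial-strain hypothesis `∃ K δ, … ∂_z u_z ≤ K`; the conclusion is the same). [new] -/
theorem axialStretchingCriterion :
    ∀ (ν T : ℝ), 0 < ν → 0 < T →
      ∀ (u : ℝ → EuclideanSpace ℝ (Fin 3) → EuclideanSpace ℝ (Fin 3)) (p : ℝ → EuclideanSpace ℝ (Fin 3) → ℝ),
      IsClassicalNSSolutionOn (Ico 0 T) ν 0 u p → IsLerayHopfOn T ν 0 (u 0) u →
      (∀ T' < T, ∃ M : ℝ, ∀ t ∈ Icc 0 T', ∀ x, ‖u t x‖ ≤ M) → (∀ t ∈ Ico 0 T, IsAxisymmetric (u t)) →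
      HasRapidSpatialDecay (u 0) →
      (∃ K δ : ℝ, 0 < δ ∧ ∀ t ∈ Ico 0 T, ∀ x : EuclideanSpace ℝ (Fin 3), 0 < cylRadius x → cylRadius x < δ →
        fderiv ℝ (u t) x (EuclideanSpace.single 2 1) 2 ≤ K) →
      HasSmoothExtensionPast ν 0 u T := by
  rintro ν T hν hT u p hcl hLH hbd hax hdec ⟨K, δ, hδ, hK⟩
  exact hasSmoothExtensionPast_of_axialStrain_le hν hT hδ hcl hLH hbd hax hdec hK

/-- **Blow-up reading: unbounded axial stretching at the axis.** In the standing class, a solution that does NOT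
extend smoothly past `T` has, for every `K` and every `δ > 0`, a time `t ∈ [0,T)` and a point `x` with
`0 < cylRadius x < δ` where `∂_z u_z (t,x) > K`. [new] -/
theorem exists_axialStretching_of_not_hasSmoothExtensionPast {ν T : ℝ} (hν : 0 < ν) (hT : 0 < T)
    {u : ℝ → EuclideanSpace ℝ (Fin 3) → EuclideanSpace ℝ (Fin 3)} {p : ℝ → EuclideanSpace ℝ (Fin 3) → ℝ}
    (hcl : IsClassicalNSSolutionOn (Ico 0 T) ν 0 u p) (hLH : IsLerayHopfOn T ν 0 (u 0) u)
    (hbd : ∀ T' < T, ∃ M : ℝ, ∀ t ∈ Icc 0 T', ∀ x, ‖u t x‖ ≤ M) (hax : ∀ t ∈ Ico 0 T, IsAxisymmetric (u t))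
    (hdec : HasRapidSpatialDecay (u 0)) (hno : ¬ HasSmoothExtensionPast ν 0 u T)
    (K : ℝ) {δ : ℝ} (hδ : 0 < δ) :
    ∃ t ∈ Ico 0 T, ∃ x : EuclideanSpace ℝ (Fin 3), 0 < cylRadius x ∧ cylRadius x < δ ∧
      K < fderiv ℝ (u t) x (EuclideanSpace.single 2 1) 2 := by
  by_contra hcon
  refine hno (hasSmoothExtensionPast_of_axialStrain_le (K := K) hν hT hδ hcl hLH hbd hax hdec ?_)
  intro t ht x hx hxδ
  by_contra hlt
  exact hcon ⟨t, ht, x, hx, hxδ, lt_of_not_ge hlt⟩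

/-! ## §3 The parabolic-core form: Type-I-rate axial stretching inside the core, any gate outside -/

/-- **Core axial-strain criterion.** For every `Λ₀ > 0` there are a core width `ξ₀ > 0` and a rate constant
`κ₀ > 0` (`ξ₀ = ξ₀(1, Λ₀)` of the two-level Reynolds gate, `κ₀ = 2/ξ₀²`) such that, for all `ν, T > 0` and every
classical solution on `[0,T)` at viscosity `ν`, Leray–Hopf from a rapidly decaying datum, with axisymmetric
slices: if on the unit tube `0 < r ≤ 1` the inflow Reynolds number is at most `Λ₀` (`u_r ≥ −νΛ₀/r`) and at the
points of the parabolic core `{0 < r < ξ₀√(ν(T−t))}` the axial strain obeys `∂_z u_z ≤ κ₀/(T−t)`, then the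
solution extends smoothly past `T`.  Proof: by `radialVelocity_ge_of_axialStrain_le` (the horizontal disc through
a core point lies in the core), `u_r ≥ −κ₀ r/(2(T−t)) = −r/(ξ₀²(T−t)) ≥ −ν/r` in the core, so the Reynolds number
there is `≤ 1 < 2` and `RadialInflowCoreReynolds.exists_coreWidth_twoLevelReynolds` (`d₀ = 1`) applies. [new] -/
theorem exists_coreWidth_axialStrainRate {Λ₀ : ℝ} (hΛ : 0 < Λ₀) :
    ∃ ξ₀ κ₀ : ℝ, 0 < ξ₀ ∧ 0 < κ₀ ∧ ∀ (ν T : ℝ), 0 < ν → 0 < T →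
      ∀ (u : ℝ → EuclideanSpace ℝ (Fin 3) → EuclideanSpace ℝ (Fin 3)) (p : ℝ → EuclideanSpace ℝ (Fin 3) → ℝ),
      IsClassicalNSSolutionOn (Ico 0 T) ν 0 u p → IsLerayHopfOn T ν 0 (u 0) u → HasRapidSpatialDecay (u 0) →
      (∀ t ∈ Ico 0 T, IsAxisymmetric (u t)) →
      (∀ t ∈ Ico 0 T, ∀ x : EuclideanSpace ℝ (Fin 3), 0 < cylRadius x → cylRadius x ≤ 1 →
        -(ν * Λ₀ / cylRadius x) ≤ radialVelocity (u t) x) →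
      (∀ t ∈ Ico 0 T, ∀ x : EuclideanSpace ℝ (Fin 3), 0 < cylRadius x →
        cylRadius x < ξ₀ * √(ν * (T - t)) → fderiv ℝ (u t) x (EuclideanSpace.single 2 1) 2 ≤ κ₀ / (T - t)) →
      HasSmoothExtensionPast ν 0 u T := by
  obtain ⟨ξ₀, hξ₀, H⟩ := exists_coreWidth_twoLevelReynolds (d₀ := 1) (Λ₀ := Λ₀) one_pos one_lt_two hΛ
  refine ⟨ξ₀, 2 / ξ₀ ^ 2, hξ₀, by positivity, fun ν T hν hT u p hcl hLH hdec hax hgate hstrain => ?_⟩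
  refine H ν T hν hT u p hcl hLH hdec hax (fun t ht x hx hx1 hcore => ?_)
    (fun t ht x hx hx1 _ => hgate t ht x hx hx1)
  have hs : 0 < T - t := by linarith [ht.2]
  have hνs : 0 < ν * (T - t) := mul_pos hν hs
  have hd : Differentiable ℝ (u t) := (hcl.contDiff_velocity ht).differentiable (by simp)
  -- the disc through `x` lies in the core, so `u_r(x) ≥ -(κ₀/(T-t)) r/2`
  have h1 := radialVelocity_ge_of_axialStrain_le (K := 2 / ξ₀ ^ 2 / (T - t)) hd (hax t ht) (hcl.divFree t ht)
    hx fun y hy0 hyx _ => hstrain t ht y hy0 (hyx.trans_lt hcore)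
  -- and `(κ₀/(T-t)) r/2 = r/(ξ₀²(T-t)) ≤ ν/r` because `r² < ξ₀² ν (T-t)`
  have hsq : cylRadius x ^ 2 < ξ₀ ^ 2 * (ν * (T - t)) := by
    have h2 : cylRadius x ^ 2 < (ξ₀ * √(ν * (T - t))) ^ 2 :=
      pow_lt_pow_left₀ hcore (cylRadius_nonneg x) two_ne_zero
    rwa [mul_pow, Real.sq_sqrt hνs.le] at h2
  have hξne : ξ₀ ^ 2 ≠ 0 := by positivity
  have hsne : T - t ≠ 0 := hs.ne'
  have h3 : 2 / ξ₀ ^ 2 / (T - t) * cylRadius x / 2 ≤ ν * 1 / cylRadius x := by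
    rw [le_div_iff₀ hx]
    have h4 : 2 / ξ₀ ^ 2 / (T - t) * cylRadius x / 2 * cylRadius x =
        cylRadius x ^ 2 / (ξ₀ ^ 2 * (T - t)) := by
      field_simp
    rw [h4, div_le_iff₀ (by positivity : (0 : ℝ) < ξ₀ ^ 2 * (T - t))]
    nlinarith
  linarith

/-- **The stub ⟨19059⟩ reduced to core axial stretching.** On the exact hypothesis list of
`stub_oneSidedRadialCriterion` (standing class; `r u_r ≥ −Cν` on `{cylRadius < δ} × [0,T)` for SOME `C`, `δ > 0`
— ANY constant, in particular the open regime `C ≥ 2`): there are `ξ₀, κ₀ > 0` (depending on the solution through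
the off-axis bound `offAxisBound`) such that the Type-I-rate one-sided axial-strain bound `∂_z u_z ≤ κ₀/(T−t)` on
the parabolic core `{0 < r < ξ₀√(ν(T−t))}` implies `HasSmoothExtensionPast ν 0 u T`.
(`RadialInflowCoreStrain.exists_unitTubeGate_of_tubeGate` + `exists_coreWidth_axialStrainRate`.) [new] -/
theorem oneSidedRadialCriterion_of_coreAxialStrain :
    ∀ (ν T : ℝ), 0 < ν → 0 < T →
      ∀ (u : ℝ → EuclideanSpace ℝ (Fin 3) → EuclideanSpace ℝ (Fin 3)) (p : ℝ → EuclideanSpace ℝ (Fin 3) → ℝ),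
      IsClassicalNSSolutionOn (Ico 0 T) ν 0 u p → IsLerayHopfOn T ν 0 (u 0) u →
      (∀ T' < T, ∃ M : ℝ, ∀ t ∈ Icc 0 T', ∀ x, ‖u t x‖ ≤ M) → (∀ t ∈ Ico 0 T, IsAxisymmetric (u t)) →
      HasRapidSpatialDecay (u 0) →
      (∃ C δ : ℝ, 0 < δ ∧ ∀ t ∈ Ico 0 T, ∀ x : EuclideanSpace ℝ (Fin 3), cylRadius x < δ →
        -(C * ν) ≤ x 0 * u t x 0 + x 1 * u t x 1) →
      ∃ ξ₀ κ₀ : ℝ, 0 < ξ₀ ∧ 0 < κ₀ ∧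
        ((∀ t ∈ Ico 0 T, ∀ x : EuclideanSpace ℝ (Fin 3), 0 < cylRadius x →
            cylRadius x < ξ₀ * √(ν * (T - t)) →
            fderiv ℝ (u t) x (EuclideanSpace.single 2 1) 2 ≤ κ₀ / (T - t)) →
          HasSmoothExtensionPast ν 0 u T) := by
  intro ν T hν hT u p hcl hLH hbd hax hdec hin
  obtain ⟨Λ₀, hΛ0, hgate⟩ := exists_unitTubeGate_of_tubeGate hν hT hcl hLH hbd hax hdec hin
  obtain ⟨ξ₀, κ₀, hξ₀, hκ₀, H⟩ := exists_coreWidth_axialStrainRate hΛ0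
  exact ⟨ξ₀, κ₀, hξ₀, hκ₀, fun hstrain => H ν T hν hT u p hcl hLH hdec hax hgate hstrain⟩

/-- **Blow-up under the gate forces Type-I-rate axial stretching inside the parabolic core.** In the standing
class of the stub, under its gate (any `C`), a solution that does NOT extend smoothly past `T` has, for the
constants `ξ₀, κ₀ > 0` of `oneSidedRadialCriterion_of_coreAxialStrain`, a time `t ∈ [0,T)` and a point `x` of
the parabolic core (`0 < r < ξ₀√(ν(T−t))`) with `∂_z u_z (t,x) > κ₀/(T−t)`. [new] -/
theorem exists_coreAxialStretching_of_not_hasSmoothExtensionPast {ν T : ℝ} (hν : 0 < ν) (hT : 0 < T)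
    {u : ℝ → EuclideanSpace ℝ (Fin 3) → EuclideanSpace ℝ (Fin 3)} {p : ℝ → EuclideanSpace ℝ (Fin 3) → ℝ}
    (hcl : IsClassicalNSSolutionOn (Ico 0 T) ν 0 u p) (hLH : IsLerayHopfOn T ν 0 (u 0) u)
    (hbd : ∀ T' < T, ∃ M : ℝ, ∀ t ∈ Icc 0 T', ∀ x, ‖u t x‖ ≤ M) (hax : ∀ t ∈ Ico 0 T, IsAxisymmetric (u t))
    (hdec : HasRapidSpatialDecay (u 0))
    (hin : ∃ C δ : ℝ, 0 < δ ∧ ∀ t ∈ Ico 0 T, ∀ x : EuclideanSpace ℝ (Fin 3), cylRadius x < δ →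
      -(C * ν) ≤ x 0 * u t x 0 + x 1 * u t x 1)
    (hno : ¬ HasSmoothExtensionPast ν 0 u T) :
    ∃ ξ₀ κ₀ : ℝ, 0 < ξ₀ ∧ 0 < κ₀ ∧ ∃ t ∈ Ico 0 T, ∃ x : EuclideanSpace ℝ (Fin 3),
      0 < cylRadius x ∧ cylRadius x < ξ₀ * √(ν * (T - t)) ∧
      κ₀ / (T - t) < fderiv ℝ (u t) x (EuclideanSpace.single 2 1) 2 := by
  obtain ⟨ξ₀, κ₀, hξ₀, hκ₀, H⟩ := oneSidedRadialCriterion_of_coreAxialStrain ν T hν hT u p hcl hLH hbd hax hdec hin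
  refine ⟨ξ₀, κ₀, hξ₀, hκ₀, ?_⟩
  by_contra hcon
  refine hno (H fun t ht x hx hcore => ?_)
  by_contra hlt
  exact hcon ⟨t, ht, x, hx, hcore, lt_of_not_ge hlt⟩

end Summit.NavierStokesRegularity.NavierStokesRegularity.Theorems.RadialInflowAxialStrain

end
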